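import Summits.KontsevichZagierPeriods.KontsevichZagierPeriods.Theorems.RootDecompRelativeModAbsoluteCylLogSplitP30

/-! # `RootDecompRelativeModAbsoluteCylLogSplitP31` — part 6/27 of the mechanical ≤400-line split of `RungClosure.lean` (sha256 f909f334226f0fb5…)
Source: decomp-kz lens-3 g12 `RungClosure.lean` v9 (HOME/decomp-kz-lens-3/g12/, sha256 f909f334…; critic g4-52/g4-57/g5 CLEARED, «lander: split v9 --supports 30572»): BLOCK I (57 g11 monolith decls missing from P01–P25), BLOCK II/III (WildCertAssembly parts 1–6, 8–10: `Leaf.cellLocalWildCert`, `Leaf.cylKernelZeroLog_of_trees`), Parts 12–13 (`Leaf.regKernelPairDegOne_iff_circlePos_of_trees`), BLOCK G13 (Möbius engine, test §C decided).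
Split by census-1 g9 `gen/splitlean.py`: scopes re-opened with their `open`/`variable`/`set_option` context; mathematics and declaration order unchanged. -/

noncomputable section
open Set MeasureTheory Filter Topology
open scoped BigOperators
open Literature.NumberTheory.Transcendental Literature.ModelTheory.ExponentialFields
namespace Summit.KontsevichZagierPeriods.RootDecompRelativeModAbsolute.Rung30571
namespace RegularisedLogLayer
namespace CylLog
variable {b : ℕ}

/-- The three elements of `Fin 3` (file-local copy; the public twin lives in an unrelated Literature module). [bookkeeping] -/
private theorem fin3_cases (t : Fin 3) : t = 0 ∨ t = 1 ∨ t = 2 := by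
  fin_cases t <;> simp

/-! ### §3aj The cell wrapper abstracted over the closing engine, the typed WILD CERTIFICATE, and
`WildCellCert → (the cell closes)` (g11 addendum 2)

`cellCloseLS_of_closedCells`: a cell of `CellCloseLS` shape closes as soon as its regularised log cells
`P_i = [band_i, (c_i/κ_i^{M_i+1}) (t−1)^{M_i}/t]` close against the polyLog base `[E, Σ_i (c_i/κ_i^{M_i+1}) polyLog_{M_i}(1+κ_i)]`
(hypothesis `hclose`, which is literally the common conclusion of `tameClose` / `wildClose`); the proof is the
V-bookkeeping of §3ag (D1 split, closed band, θ-constant and monomial folds, dummy cells for `κ_i ≡ 0`, `hpoly`). -/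

open scoped ContDiff in
/-- **The cell wrapper abstracted over the closing engine.** Data of a `CellCloseLS` cell (without the
relation data); hypothesis `hclose` = the common conclusion shape of `tameClose` / `wildClose` for the cell's
regularised log cells and polyLog base; conclusion `[V] ∈ KZ.relations`. -/
theorem cellCloseLS_of_closedCells
    (E : Set (Fin 1 → ℝ)) (V : KZ.IntegralRep (1 + 1)) (a₀ : (Fin 1 → ℝ) → ℝ) (q : ℕ)
    (c κ : Fin q → (Fin 1 → ℝ) → ℝ) (M : Fin q → ℕ) (σ : Fin q → Fin 3)
    (hEo : IsOpen E) (hE : IsSemialgebraic ℚ E)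
    (ha₀ : IsSemialgebraicFunOn ℚ E a₀) (_ha_sm : ContDiffOn ℝ ∞ a₀ E) (ha₀i : IntegrableOn a₀ E)
    (hc : ∀ i, IsSemialgebraicFunOn ℚ E (c i)) (_hc_sm : ∀ i, ContDiffOn ℝ ∞ (c i) E)
    (hκ : ∀ i, IsSemialgebraicFunOn ℚ E (κ i)) (hκ_sm : ∀ i, ContDiffOn ℝ ∞ (κ i) E)
    (hκ1 : ∀ i, ∀ x ∈ E, -1 < κ i x)
    (hσ0 : ∀ i, σ i = 0 → ∀ x ∈ E, 0 < κ i x) (hσ1 : ∀ i, σ i = 1 → ∀ x ∈ E, κ i x < 0)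
    (hσ2 : ∀ i, σ i = 2 → ∀ x ∈ E, κ i x = 0)
    (hint : ∀ i, IntegrableOn (fun z : Fin (1 + 1) → ℝ =>
      c i (Fin.init z) * (z (Fin.last 1) ^ M i / (1 + z (Fin.last 1) * κ i (Fin.init z))))
      {z : Fin (1 + 1) → ℝ | (Fin.init z : Fin 1 → ℝ) ∈ E ∧ z (Fin.last 1) ∈ Set.Ioo 0 1})
    (hL1 : ∀ i, IntegrableOn (fun x => c i x * ∫ θ in Set.Ioo (0 : ℝ) 1, θ ^ M i / (1 + θ * κ i x)) E)
    (hdom : V.domain = {z : Fin (1 + 1) → ℝ | (Fin.init z : Fin 1 → ℝ) ∈ E ∧ z (Fin.last 1) ∈ Set.Ioo 0 1})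
    (hV : Set.EqOn V.integrand (fun z => a₀ (Fin.init z) +
      ∑ i, c i (Fin.init z) * (z (Fin.last 1) ^ M i / (1 + z (Fin.last 1) * κ i (Fin.init z))))
      V.domain)
    (hpoly : ∀ x ∈ E, a₀ x + ∑ i, polyPart (sgnB σ) c κ M i x = 0)
    (hclose : ∀ (P : Fin q → KZ.IntegralRep (1 + 1)) (B : KZ.IntegralRep 1),
      (∀ i, (P i).domain = if σ i ≠ 1 then KZlog.band E (fun _ => 1) (fun x => 1 + κ i x)
        else KZlog.band E (fun x => 1 + κ i x) (fun _ => 1)) →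
      (∀ i, EqOn (P i).integrand (fun z => c i (Fin.init z) / κ i (Fin.init z) ^ (M i + 1) *
        ((z (Fin.last 1) - 1) ^ M i / z (Fin.last 1))) (P i).domain) →
      B.domain = E →
      EqOn B.integrand (fun x => ∑ i, c i x / κ i x ^ (M i + 1) * polyLog (M i) (1 + κ i x)) E →
      ∑ i, (if σ i ≠ 1 then (1:ℤ) else -1) • KZ.of (P i) - KZ.of B ∈ KZ.relations) :
    KZ.of V ∈ KZ.relations := by
  classical
  set cylE : Set (Fin (1 + 1) → ℝ) :=
    {z : Fin (1 + 1) → ℝ | (Fin.init z : Fin 1 → ℝ) ∈ E ∧ z (Fin.last 1) ∈ Set.Ioo 0 1} with hcylE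
  have hEm : MeasurableSet E := hE.measurableSet_holds
  have hcyl : IsSemialgebraic ℚ cylE := RTerm.isSemialgebraic_cyl hE
  have hcylG : cylE ⊆ {z | (Fin.init z : Fin 1 → ℝ) ∈ E} := fun z hz => hz.1
  have h0sa : IsSemialgebraicFunOn ℚ E (fun _ => (0:ℝ)) :=
    (isSemialgebraicFunOn_ratCast hE 0).congr fun _ _ => by simp
  have h1sa : IsSemialgebraicFunOn ℚ E (fun _ => (1:ℝ)) :=
    (isSemialgebraicFunOn_ratCast hE 1).congr fun _ _ => by simp
  have hband : IsSemialgebraic ℚ (KZlog.band E (fun _ => (0:ℝ)) (fun _ => 1)) :=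
    KZlog.isSemialgebraic_band h0sa h1sa
  have hbandG : KZlog.band E (fun _ => (0:ℝ)) (fun _ => 1) ⊆ {z | (Fin.init z : Fin 1 → ℝ) ∈ E} :=
    fun z hz => hz.1
  have hcyl_band : cylE ⊆ KZlog.band E (fun _ => (0:ℝ)) (fun _ => 1) :=
    fun z hz => ⟨hz.1, hz.2.1.le, hz.2.2.le⟩
  -- no poles on the closed band
  have hden_band : ∀ i, ∀ z ∈ KZlog.band E (fun _ => (0:ℝ)) (fun _ => 1),
      1 + z (Fin.last 1) * κ i (Fin.init z) ≠ 0 := fun i z hz =>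
    (one_add_mul_pos_of_gt_neg_one hz.2.1 hz.2.2 (hκ1 i _ hz.1)).ne'
  have hden_cyl : ∀ i, ∀ z ∈ cylE, 1 + z (Fin.last 1) * κ i (Fin.init z) ≠ 0 :=
    fun i z hz => hden_band i z (hcyl_band hz)
  -- the pieces on the open cylinder
  have hTm_cyl : ∀ i, IsSemialgebraicFunOn ℚ cylE (fun z => c i (Fin.init z) *
      (z (Fin.last 1) ^ M i / (1 + z (Fin.last 1) * κ i (Fin.init z)))) :=
    fun i => sa_cylTerm (M i) hcyl hcylG (hc i) (hκ i) (hden_cyl i)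
  have hTm_band : ∀ i, IsSemialgebraicFunOn ℚ (KZlog.band E (fun _ => (0:ℝ)) (fun _ => 1))
      (fun z => c i (Fin.init z) * (z (Fin.last 1) ^ M i / (1 + z (Fin.last 1) * κ i (Fin.init z)))) :=
    fun i => sa_cylTerm (M i) hband hbandG (hc i) (hκ i) (hden_band i)
  have ha₀cyl : IsSemialgebraicFunOn ℚ cylE (fun z => a₀ (Fin.init z)) := ha₀.comp_init.mono hcylG hcyl
  have ha₀band : IsSemialgebraicFunOn ℚ (KZlog.band E (fun _ => (0:ℝ)) (fun _ => 1))
      (fun z => a₀ (Fin.init z)) := ha₀.comp_init.mono hbandG hband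
  have hA₀int : IntegrableOn (fun z : Fin (1 + 1) → ℝ => a₀ (Fin.init z))
      (KZlog.band E (fun _ => (0:ℝ)) (fun _ => 1)) := integrableOn_comp_init_band hE ha₀ ha₀i
  let A : KZ.IntegralRep (1 + 1) :=
    { domain := cylE, integrand := fun z => a₀ (Fin.init z), isSemialgebraic_domain := hcyl,
      isSemialgebraicFunOn_integrand := ha₀cyl, integrableOn := hA₀int.mono_set hcyl_band }
  let Cy : Fin q → KZ.IntegralRep (1 + 1) := fun i =>
    { domain := cylE,
      integrand := fun z => c i (Fin.init z) * (z (Fin.last 1) ^ M i / (1 + z (Fin.last 1) * κ i (Fin.init z))),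
      isSemialgebraic_domain := hcyl, isSemialgebraicFunOn_integrand := hTm_cyl i, integrableOn := hint i }
  -- (1) D1: split the integrand
  have r1 : KZ.of V - KZ.of A - ∑ i, KZ.of (Cy i) ∈ KZ.relations :=
    KZ.of_sub_of_sub_sum_mem_relations q V A Cy (by rw [hdom]) (fun i => by rw [hdom])
      fun z hz => by rw [hV hz]
  -- (2) the `θ`-constant term: open → closed band → base `[E, a₀]`
  obtain ⟨A', hA'd, hA'i, r2⟩ := exists_closedBand_of_openCell' (a := fun _ => (0:ℝ))
    (c := fun _ => (1:ℝ)) h0sa h1sa A rfl (fun z => a₀ (Fin.init z)) ha₀band (fun _ _ => rfl)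
  obtain ⟨Ba, hBad, hBai, r3⟩ := exists_base_of_thetaConst hE ha₀ ha₀i A' hA'd hA'i
  -- (3) the per-index packages
  let d : Fin q → (Fin 1 → ℝ) → ℝ := fun i x => c i x / κ i x ^ (M i + 1)
  let W : Fin q → (Fin 1 → ℝ) → ℝ := fun i x => 1 + κ i x
  let σB : Fin q → Bool := fun i => decide (σ i ≠ 1)
  let ε : Fin q → ℤ := fun i => if σB i then 1 else -1
  let Dom : Fin q → Set (Fin (1 + 1) → ℝ) := fun i =>
    if σB i then KZlog.band E (fun _ => 1) (W i) else KZlog.band E (W i) (fun _ => 1)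
  have hWsa : ∀ i, IsSemialgebraicFunOn ℚ E (W i) := fun i => IsSemialgebraicFunOn.add_holds h1sa (hκ i)
  have hκd : ∀ i, DifferentiableOn ℝ (κ i) E := fun i => (hκ_sm i).differentiableOn (by simp)
  have hWd : ∀ i, DifferentiableOn ℝ (W i) E := fun i => (differentiableOn_const _).add (hκd i)
  have hci2 : ∀ i, σ i = 2 → IntegrableOn (c i) E := by
    intro i h2
    refine IntegrableOn.congr_fun (((hL1 i).mul_const ((M i : ℝ) + 1))) (fun x hx => ?_) hEm
    have hM : ((M i : ℝ) + 1) ≠ 0 := by positivity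
    simp only [hσ2 i h2 x hx, fibreIntegral_zero]
    field_simp
  have hX : ∀ i, ∃ (P : KZ.IntegralRep (1 + 1)) (Bb : KZ.IntegralRep 1),
      P.domain = Dom i ∧
      EqOn P.integrand (fun z => d i (Fin.init z) * ((z (Fin.last 1) - 1) ^ M i / z (Fin.last 1))) P.domain ∧
      Bb.domain = E ∧ (Bb.integrand = fun x => if σ i = 2 then c i x / ((M i : ℝ) + 1) else 0) ∧
      KZ.of (Cy i) - ε i • KZ.of P - KZ.of Bb ∈ KZ.relations := by
    intro i
    -- the zero base representation
    let Z : KZ.IntegralRep 1 :=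
      { domain := E, integrand := fun _ => 0, isSemialgebraic_domain := hE,
        isSemialgebraicFunOn_integrand := h0sa, integrableOn := integrableOn_zero }
    have hZ : KZ.of Z ∈ KZ.relations := KZ.of_mem_relations_of_eqOn_zero Z fun _ _ => rfl
    rcases fin3_cases (σ i) with h0 | h1 | h2
    · -- `κᵢ > 0`: closed band, then D4 (`exists_regRep_sub_mem_relations`)
      have hσB : σB i = true := by simp [σB, h0]
      have hε : ε i = 1 := by simp [ε, hσB]
      obtain ⟨Cy', hCy'd, hCy'i, r4⟩ := exists_closedBand_of_openCell' (a := fun _ => (0:ℝ))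
        (c := fun _ => (1:ℝ)) h0sa h1sa (Cy i) rfl _ (hTm_band i) (fun _ _ => rfl)
      obtain ⟨Rg, hRgd, hRgi, r5⟩ := exists_regRep_sub_mem_relations (M := M i) hEo hE (hc i) (hκ i)
        (hκd i) (hσ0 i h0) Cy' hCy'd (fun z _ => by rw [hCy'i])
      refine ⟨Rg, Z, ?_, ?_, rfl, ?_, ?_⟩
      · simp only [Dom, hσB]; exact hRgd
      · intro z _; rw [hRgi]
      · funext x; show (0:ℝ) = _; simp [h0]
      · rw [hε, one_smul]
        have h := KZ.relations.sub_mem (KZ.relations.add_mem r4 r5) hZ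
        convert h using 1
        abel
    · -- `κᵢ < 0`: closed band, then D4⁻ (`exists_regNegRep_sub_mem_relations`) and the sign flip
      have hσB : σB i = false := by simp [σB, h1]
      have hε : ε i = -1 := by simp [ε, hσB]
      obtain ⟨Cy', hCy'd, hCy'i, r4⟩ := exists_closedBand_of_openCell' (a := fun _ => (0:ℝ))
        (c := fun _ => (1:ℝ)) h0sa h1sa (Cy i) rfl _ (hTm_band i) (fun _ _ => rfl)
      obtain ⟨Rg, hRgd, hRgi, r5⟩ := exists_regNegRep_sub_mem_relations (M := M i) hEo hE (hc i) (hκ i)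
        (hκd i) (hσ1 i h1) (hκ1 i) Cy' hCy'd (fun z _ => by rw [hCy'i])
      let R' : KZ.IntegralRep (1 + 1) :=
        { domain := Rg.domain, integrand := fun z => -Rg.integrand z,
          isSemialgebraic_domain := Rg.isSemialgebraic_domain,
          isSemialgebraicFunOn_integrand := Rg.isSemialgebraicFunOn_integrand.neg,
          integrableOn := Rg.integrableOn.neg }
      have r6 : KZ.of Rg + KZ.of R' ∈ KZ.relations :=
        KZ.of_add_of_mem_relations_of_eqOn_neg (r := Rg) (r' := R') rfl fun z _ => rfl
      refine ⟨R', Z, ?_, ?_, rfl, ?_, ?_⟩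
      · simp only [Dom, hσB]; exact hRgd
      · intro z _
        show -Rg.integrand z = _
        rw [hRgi]
        ring
      · funext x; show (0:ℝ) = _; simp [h1]
      · rw [hε, neg_smul, one_smul, sub_neg_eq_add]
        have h := KZ.relations.sub_mem (KZ.relations.add_mem (KZ.relations.add_mem r4 r5) r6) hZ
        convert h using 1
        abel
    · -- `κᵢ ≡ 0`: closed band with the MONOMIAL integrand, fold to the base; the cell is a dummy zero cell
      have hσB : σB i = true := by simp [σB, h2]
      have hε : ε i = 1 := by simp [ε, hσB]
      have hmono : IsSemialgebraicFunOn ℚ (KZlog.band E (fun _ => (0:ℝ)) (fun _ => 1))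
          (fun z => c i (Fin.init z) * z (Fin.last 1) ^ M i) :=
        IsSemialgebraicFunOn.mul_holds ((hc i).comp_init.mono hbandG hband)
          (isSemialgebraicFunOn_pow' hband (Literature.NumberTheory.Transcendental.isSemialgebraicFunOn_apply hband (Fin.last 1)) (M i))
      obtain ⟨Cy', hCy'd, hCy'i, r4⟩ := exists_closedBand_of_openCell' (a := fun _ => (0:ℝ))
        (c := fun _ => (1:ℝ)) h0sa h1sa (Cy i) rfl _ hmono (fun z hz => by
          have hx : Fin.init z ∈ E := hz.1
          show c i (Fin.init z) * (z (Fin.last 1) ^ M i / (1 + z (Fin.last 1) * κ i (Fin.init z))) = _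
          rw [hσ2 i h2 _ hx, mul_zero, add_zero, div_one])
      obtain ⟨Bb, hBbd, hBbi, r5⟩ := exists_base_of_monomial (M := M i) hE (hc i) (hci2 i h2) Cy' hCy'd hCy'i
      let Pd : KZ.IntegralRep (1 + 1) :=
        { domain := KZlog.band E (fun _ => 1) (W i), integrand := fun _ => 0,
          isSemialgebraic_domain := KZlog.isSemialgebraic_band h1sa (hWsa i),
          isSemialgebraicFunOn_integrand :=
            (isSemialgebraicFunOn_ratCast (KZlog.isSemialgebraic_band h1sa (hWsa i)) 0).congr
              fun _ _ => by simp,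
          integrableOn := integrableOn_zero }
      have hPd0 : KZ.of Pd ∈ KZ.relations := KZ.of_mem_relations_of_eqOn_zero Pd fun _ _ => rfl
      refine ⟨Pd, Bb, ?_, ?_, hBbd, ?_, ?_⟩
      · simp only [Dom, hσB]; rfl
      · intro z hz
        have hx : Fin.init z ∈ E := hz.1
        show (0:ℝ) = d i (Fin.init z) * _
        simp only [d, hσ2 i h2 _ hx, zero_pow (Nat.succ_ne_zero _), div_zero, zero_mul]
      · rw [hBbi]; funext x; simp [h2]
      · rw [hε, one_smul]
        have h := KZ.relations.sub_mem (KZ.relations.add_mem r4 r5) hPd0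
        convert h using 1
        abel
  choose P Bb hPd hPi hBbd hBbi hXr using hX
  -- (5) the consolidated base `B = [E, −(a₀ + Σ Bbᵢ)] ≡ [E, Σ dᵢ polyLog_{Mᵢ}(Wᵢ)]` (by `hpoly`)
  have hBbsa : ∀ i, IsSemialgebraicFunOn ℚ E (Bb i).integrand := fun i => by
    rw [← hBbd i]; exact (Bb i).isSemialgebraicFunOn_integrand
  have hBbint : ∀ i, IntegrableOn (Bb i).integrand E := fun i => by
    rw [← hBbd i]; exact (Bb i).integrableOn
  let Bsum : KZ.IntegralRep 1 :=
    { domain := E, integrand := fun x => a₀ x + ∑ i, (Bb i).integrand x, isSemialgebraic_domain := hE,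
      isSemialgebraicFunOn_integrand := IsSemialgebraicFunOn.add_holds ha₀
        (KZ.isSemialgebraicFunOn_finset_sum Finset.univ hE fun i _ => hBbsa i),
      integrableOn := ha₀i.add (integrable_finsetSum Finset.univ fun i _ => hBbint i) }
  let B : KZ.IntegralRep 1 :=
    { domain := E, integrand := fun x => -(a₀ x + ∑ i, (Bb i).integrand x), isSemialgebraic_domain := hE,
      isSemialgebraicFunOn_integrand := Bsum.isSemialgebraicFunOn_integrand.neg,
      integrableOn := Bsum.integrableOn.neg }
  have rb1 : KZ.of Bsum - KZ.of Ba - ∑ i, KZ.of (Bb i) ∈ KZ.relations :=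
    KZ.of_sub_of_sub_sum_mem_relations q Bsum Ba Bb hBad (fun i => hBbd i) fun x _ => by
      show a₀ x + ∑ i, (Bb i).integrand x = Ba.integrand x + ∑ i, (Bb i).integrand x
      rw [hBai]
  have rb2 : KZ.of Bsum + KZ.of B ∈ KZ.relations :=
    KZ.of_add_of_mem_relations_of_eqOn_neg (r := Bsum) (r' := B) rfl fun _ _ => rfl
  have hBi : EqOn B.integrand (fun x => ∑ i, d i x * polyLog (M i) (W i x)) E := by
    intro x hx
    show -(a₀ x + ∑ i, (Bb i).integrand x) = ∑ i, d i x * polyLog (M i) (W i x)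
    have hp := hpoly x hx
    have hpp : ∀ i, polyPart (sgnB σ) c κ M i x = (Bb i).integrand x + d i x * polyLog (M i) (W i x) := by
      intro i
      rw [hBbi i]
      by_cases h2 : σ i = 2
      · have hs : sgnB σ i = false := by simp [sgnB, h2]
        show polyPart (sgnB σ) c κ M i x =
          (if σ i = 2 then c i x / ((M i : ℝ) + 1) else 0) + c i x / κ i x ^ (M i + 1) * polyLog (M i) (1 + κ i x)
        simp [polyPart, hs, h2, hσ2 i h2 x hx]
      · have hs : sgnB σ i = true := by simp [sgnB, h2]
        show polyPart (sgnB σ) c κ M i x =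
          (if σ i = 2 then c i x / ((M i : ℝ) + 1) else 0) + c i x / κ i x ^ (M i + 1) * polyLog (M i) (1 + κ i x)
        simp only [polyPart, hs, h2, if_true, if_false, zero_add]
        ring
    rw [Finset.sum_congr rfl fun i _ => hpp i, Finset.sum_add_distrib] at hp
    linarith
  -- (6) the cells close (hypothesis `hclose`)
  have hDomEq : ∀ i, Dom i = if σ i ≠ 1 then KZlog.band E (fun _ => 1) (fun x => 1 + κ i x)
      else KZlog.band E (fun x => 1 + κ i x) (fun _ => 1) := fun i => by
    by_cases h : σ i = 1 <;> simp [Dom, σB, W, h]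
  have hεEq : ∀ i, (if σ i ≠ 1 then (1:ℤ) else -1) = ε i := fun i => by
    by_cases h : σ i = 1 <;> simp [ε, σB, h]
  have hT : ∑ i, ε i • KZ.of (P i) - KZ.of B ∈ KZ.relations := by
    have h := hclose P B (fun i => (hPd i).trans (hDomEq i)) (fun i => hPi i) rfl hBi
    simpa only [hεEq] using h
  -- (7) assemble
  have hXs := sum_mem fun i (_ : i ∈ (Finset.univ : Finset (Fin q))) => hXr i
  have key : KZ.of V = (KZ.of V - KZ.of A - ∑ i, KZ.of (Cy i)) + (KZ.of A - KZ.of A') +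
      (KZ.of A' - KZ.of Ba) + ∑ i, (KZ.of (Cy i) - ε i • KZ.of (P i) - KZ.of (Bb i)) +
      (∑ i, ε i • KZ.of (P i) - KZ.of B) - (KZ.of Bsum - KZ.of Ba - ∑ i, KZ.of (Bb i)) +
      (KZ.of Bsum + KZ.of B) := by
    simp only [Finset.sum_sub_distrib]
    abel
  rw [key]
  exact KZ.relations.add_mem (KZ.relations.sub_mem (KZ.relations.add_mem (KZ.relations.add_mem
    (KZ.relations.add_mem (KZ.relations.add_mem r1 r2) r3) hXs) hT) rb1) rb2

/-- **WILD CERTIFICATE** of a cell (data `E c κ M σ` of `CellCloseLS`): the side conditions of `wildClose` in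
cell coordinates — regularised coefficients `d_i = c_i/κ_i^{M_i+1}`, edges `W_i = 1 + κ_i`, orientation `σ_i ≠ 1`,
padded edges `zW`.  A set `Z` of indices raised to a common order `m`; exact multiplicative relations `g`
supported on `Z`; a semialgebraic decomposition `(−1)^{M_i} d_i = Σ_r qq_r g_ri + Ñ_i` with `Σ Ñ_i log(1+κ_i) = 0`;
and the HONESTY bounds of every auxiliary cell (raising, splitting, torus, tameness of the remainder `Ñ`).
It is what the one-variable analysis of g12 must produce on each LOCALISED wild cell (one singular end per
index); on an un-localised cell it can fail (an index with a `κ → 0` end and a `κ → ∞` end cannot be raised). -/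
def WildCellCert {q : ℕ} (E : Set (Fin 1 → ℝ)) (c κ : Fin q → (Fin 1 → ℝ) → ℝ) (M : Fin q → ℕ)
    (σ : Fin q → Fin 3) : Prop :=
  ∃ (Z : Fin q → Bool) (m a : ℕ) (g : Fin a → Fin q → ℤ) (qq : Fin a → (Fin 1 → ℝ) → ℝ)
    (Nn : Fin q → (Fin 1 → ℝ) → ℝ),
    (∀ i, Z i = true → M i ≤ m) ∧
    (∀ r i, Z i = false → g r i = 0) ∧
    (∀ r, ∀ x ∈ E, ∏ i, (1 + κ i x) ^ (g r i) = 1) ∧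
    (∀ r, IsSemialgebraicFunOn ℚ E (qq r)) ∧
    (∀ i, IsSemialgebraicFunOn ℚ E (Nn i)) ∧
    (∀ i, ∀ x ∈ E, (-1) ^ M i * (c i x / κ i x ^ (M i + 1)) = ∑ r, qq r x * (g r i : ℝ) + Nn i x) ∧
    (∀ x ∈ E, ∑ i, Nn i x * Real.log (1 + κ i x) = 0) ∧
    (∀ i, Z i = true → ∀ j, M i ≤ j → j ≤ m →
      IntegrableOn (fun x => c i x / κ i x ^ (M i + 1) * κ i x ^ (j + 1)) E) ∧
    (∀ i, Z i = true → σ i = 1 → ∀ j, M i ≤ j → j ≤ m →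
      IntegrableOn (fun x => c i x / κ i x ^ (M i + 1) * (-κ i x) ^ (j + 1) / (1 + κ i x)) E) ∧
    (∀ r i, Z i = true → IntegrableOn (fun x => qq r x * κ i x ^ (m + 1)) E) ∧
    (∀ r i, Z i = true → σ i = 1 →
      IntegrableOn (fun x => qq r x * (-κ i x) ^ (m + 1) / (1 + κ i x)) E) ∧
    (∀ i, Z i = true → IntegrableOn (fun x => Nn i x * κ i x ^ (m + 1)) E) ∧
    (∀ i, Z i = true → σ i = 1 → IntegrableOn (fun x => Nn i x * (-κ i x) ^ (m + 1) / (1 + κ i x)) E) ∧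
    (∀ r, (∀ x ∈ E, 1 ≤ ∏ i, zW Z (fun i x => 1 + κ i x) i x ^ (g r i).toNat) ∨
      (∀ x ∈ E, ∏ i, zW Z (fun i x => 1 + κ i x) i x ^ (g r i).toNat ≤ 1)) ∧
    (∀ r, IntegrableOn (fun x => qq r x *
      (∏ i, zW Z (fun i x => 1 + κ i x) i x ^ multUp (g r) (fun i => decide (σ i ≠ 1)) i - 1) ^ (m + 1)) E) ∧
    (∀ r, IntegrableOn (fun x => qq r x *
      (1 - ∏ i, zW Z (fun i x => 1 + κ i x) i x ^ multUp' (g r) (fun i => decide (σ i ≠ 1)) i) ^ (m + 1) /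
        ∏ i, zW Z (fun i x => 1 + κ i x) i x ^ multUp' (g r) (fun i => decide (σ i ≠ 1)) i) E) ∧
    (∀ r, IntegrableOn (fun x => qq r x *
      (∏ i, zW Z (fun i x => 1 + κ i x) i x ^ multDn (g r) (fun i => decide (σ i ≠ 1)) i - 1) ^ (m + 1)) E) ∧
    (∀ r, IntegrableOn (fun x => qq r x *
      (1 - ∏ i, zW Z (fun i x => 1 + κ i x) i x ^ multDn' (g r) (fun i => decide (σ i ≠ 1)) i) ^ (m + 1) /
        ∏ i, zW Z (fun i x => 1 + κ i x) i x ^ multDn' (g r) (fun i => decide (σ i ≠ 1)) i) E) ∧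
    (∀ i, IntegrableOn (fun x => Nn i x * Real.log (1 + κ i x)) E) ∧
    (∀ i, σ i ≠ 1 → ∀ j, j < (if Z i then m else M i) →
      IntegrableOn (fun x => Nn i x * κ i x ^ (j + 1)) E)

end CylLog
end RegularisedLogLayer
end Summit.KontsevichZagierPeriods.RootDecompRelativeModAbsolute.Rung30571
end
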